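import Literature.AlgebraicGeometry.ShimuraVarieties.UnitaryShimuraCurvePolarizationTypeOfSpecialFibres
import Literature.AlgebraicGeometry.AbelianSchemes.LevelStructureSymplecticClassLocusClopen
import Literature.AlgebraicGeometry.AbelianSchemes.PolarizationHasTypeOfSymplecticLift
import HarnessLib

/-!
# Symplectic-liftability of a level structure over the thickened unitary Shimura curve `X = (M_K) ⊗_L Fᵢ` is read off the special complex fibres
# ([Lan2013PELCompactifications] §1.3.6 Lemma 1.3.6.6 / Cor. 1.3.6.7; [Deligne1979ShimuraVarieties] 2.1.2–2.1.3)

Topic `AlgebraicGeometry/ShimuraVarieties`; namespace `Literature.AlgebraicGeometry.ShimuraVarieties.UnitaryCanonicalModel.RecordSystemGS` (§1 is a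
dot-notation extension of ★ `AbelianSchemeOver.LevelStructure`, declared with its absolute name).  THEOREMS ONLY (no definition, no named fact, no
instance, no notation, no `sorry`).  The SYMPLECTIC TWIN of ★ `UnitaryShimuraCurvePolarizationTypeOfSpecialFibres` (the `HasType δ` of a polarisation
over `X` from the special complex fibres): sequel of ★ `UnitaryShimuraCurveHomRigidityOfSpecialFibres` (one special complex point per connected component
of `X`, §2 there) and ★ `LevelStructureSymplecticClassLocusClopen` (one symplectic lift at one geometric point spreads over the connected component, no
reducedness).  Cell `hodgecm-mathlib` (D-0151), FLOOR 0, P6 «MOD» (crux hLiu418 = stmt-HodgeConjecture-24832, `--supports`): organ (m1) of the (γ′) road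
«SERRE TENSOR OVER `X`, CLASSIFIED» for the E-sheet socket `hole_SHEET_complex` (LA4-plan (g2) BOOK v3, LA7-p01 (g4) LEG-E(γ′) census 2026-09-02): the
`hsymp` binder of ★ `SerreTwistModuliTupleRowA.exists_serreTwist_moduliTuple_of_isCMField_rowA` over the NON-connected base `X`, which the
`[PreconnectedSpace S]` heads ★ `isSymplecticLiftable_of_markedComplexFibre(_comp)` cannot serve; the (B1) organ «fibre lift at the special sheet
points» produces exactly the hypothesis `h` of §2.  HC_CM is proved only modulo the printed citations (2 remaining named inputs hLiu418 24832, h413 24833)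
until rung 0 closes; this file is generic in the polarised abelian scheme with level structure and changes no count.

THE MATHEMATICS.  [Lan2013PELCompactifications] Lemma 1.3.6.6 / Cor. 1.3.6.7: over a locally Noetherian base `S` in which every positive integer is
invertible, a level structure `φ` is symplectic-liftable (of type `δ`, for the polarisation `λ`) as soon as it admits ONE symplectic lift at ONE
geometric point of each connected component — the component is an OPEN subscheme (`S` locally Noetherian, hence locally connected), the lift spreads
over it (★ `LevelStructure.nonempty_symplecticLift_of_mem_connectedComponent`), and the tree's carrier ★ `LevelStructure.IsSymplecticLiftable` is the
pointwise clause (§1).  Over `X = (M_K) ⊗_L Fᵢ` (smooth over the field `Fᵢ ⊇ L ⊇ ℚ`: locally Noetherian, residue characteristic `0`) every connected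
component receives a special complex point (★ `exists_specialPoint_base_mem_connectedComponent`), so one lift at each special complex fibre — in
honest-point or in sheet currency `ℓ_{τE}(z₀)`, `z₀ = (S.pts K)⁻¹ [τw, aK]` — gives symplectic-liftability over `X` (§2).

* §1 `AbelianSchemeOver.LevelStructure.isSymplecticLiftable_of_forall_exists_symplecticLift` (+ `_of_charZero`).
* §2 **`isSymplecticLiftable_of_forall_specialPoint`**, **`isSymplecticLiftable_of_forall_specialPoint_sheet`** — THE HEADS over `X`.
* §3 **`hasType_and_isSymplecticLiftable_of_forall_specialPoint_sheet`** — BOTH binders `(hT, hsymp)` of ★ LEG-A from ONE witness-and-lift per special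
  sheet point (the `δ`-clause of the `HasType` twin is read off the lift by ★ `Polarization.exists_mulHom_range_eq_kerPointsAt_of_symplecticLift`).

## References
* [Lan2013PELCompactifications] K.-W. Lan, *Arithmetic compactifications of PEL-type Shimura varieties*, LMS Monographs 36 (2013), §1.3.6
  Lemma 1.3.6.6 and Cor. 1.3.6.7 (pp. 81–82).
* [MumfordFogartyKirwan1994] D. Mumford, J. Fogarty, F. Kirwan, *Geometric Invariant Theory*, 3rd ed. (1994), App. 7A (pp. 234–235).
* [Deligne1979ShimuraVarieties] P. Deligne, *Variétés de Shimura* (1979), 2.1.2–2.1.3.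
* Tree: ★ `LevelStructureSymplecticClassLocusClopen` (§1 engine), ★ `UnitaryShimuraCurveHomRigidityOfSpecialFibres` (§2, §4), ★
  `UnitaryShimuraCurvePolarizationTypeOfSpecialFibres` (the `HasType` twin), ★ `PolarizationHasTypeOfSymplecticLift` (the `δ`-clause from a lift, §3).
-/

set_option autoImplicit false

noncomputable section

universe u

open Matrix NumberField CategoryTheory CategoryTheory.Limits AlgebraicGeometry Topology
open scoped MonObj
open Literature.NumberTheory.Automorphic.Liu2021.AppendixC (C5.OpenCompactSubgroup C5.SmallLevel)
open Literature.NumberTheory.Automorphic.UnitaryGroup (finAdelic)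
open Literature.AlgebraicGeometry.Motives (ComplexPoints AlgPoints SchemeOver baseChange CartierDivisor)
open Literature.AlgebraicGeometry.Motives.AbelianVariety (bcSpec)
open Literature.AlgebraicGeometry.AbelianSchemes (AbelianSchemeOver)
open Literature.AlgebraicGeometry.ModuliOfAbelianVarieties (IsPolarizationType)

namespace Literature.AlgebraicGeometry.ShimuraVarieties.UnitaryCanonicalModel

variable {L : Type} [Field L] [NumberField L] [IsCMField L] {Jstar : Matrix (Fin 2) (Fin 2) L} {τ : L →+* ℂ}
  {K₀ : C5.OpenCompactSubgroup ↥(finAdelic (↥(maximalRealSubfield L)) L (IsCMField.complexConj L) 2 Jstar)}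

namespace RecordSystemGS

/-! ### §1 Generic: symplectic-liftability from one lift per connected component -/

/-- Over a field of characteristic zero every positive integer is invertible in every residue field (the `hQ` shape of ★
`LevelStructureSymplecticClassLocusClopen`). [folklore] -/
private theorem natCast_residueField_ne_zero_of_charZero' {S : Scheme.{u}} {K : Type u} [Field K] [CharZero K]
    (f : S ⟶ Spec (.of K)) (M : ℕ) (hM : M ≠ 0) (s : S) : (M : S.residueField s) ≠ 0 := by
  let φ : K →+* S.residueField s := (Spec.preimage (S.fromSpecResidueField s ≫ f)).hom
  rw [← map_natCast φ M]
  exact (map_ne_zero φ).mpr (Nat.cast_ne_zero.mpr hM)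

/-- **Symplectic-liftability from ONE symplectic lift PER CONNECTED COMPONENT** (dot-notation extension of ★ `AbelianSchemeOver.LevelStructure`,
absolute name): over a locally Noetherian `S` with every positive integer invertible in its residue fields, for an abelian scheme `A → S` of relative
dimension `g₀`, a level-`N` structure `φ` (`N ≠ 0`) and a polarisation `λ`, if every `x ∈ S` has a geometric point `s₀` (algebraically closed field)
centred in its connected component carrying a witness `Θ₀` of `λ̄_{s₀}` and a symplectic lift of `φ(s₀)` of type `δ`, then `φ` is symplectic-liftable of
type `δ` for `λ` — the carrier ★ `IsSymplecticLiftable` is the pointwise clause, and one lift spreads over the (open) connected component by ★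
`LevelStructure.nonempty_symplecticLift_of_mem_connectedComponent` (no reducedness); the symplectic twin of ★ `Polarization.hasType_of_forall_exists_mulHom`.
[cite: Lan2013PELCompactifications, §1.3.6 Lemma 1.3.6.6 and Cor. 1.3.6.7 (pp. 81–82)] -/
theorem _root_.Literature.AlgebraicGeometry.AbelianSchemes.AbelianSchemeOver.LevelStructure.isSymplecticLiftable_of_forall_exists_symplecticLift
    {S : Scheme.{u}} [IsLocallyNoetherian S] {A : AbelianSchemeOver S} {g₀ : ℕ} (hg : A.IsOfRelDim g₀)
    (hQ : ∀ M : ℕ, M ≠ 0 → ∀ s : S, (M : S.residueField s) ≠ 0) {N : ℕ} (φ : A.LevelStructure g₀ N) (hN : N ≠ 0)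
    {D : A.DualPair} (pol : A.Polarization D) (δ : Fin g₀ → ℕ)
    (h : ∀ x : S, ∃ (Ω₀ : Type u) (_ : Field Ω₀) (_ : IsAlgClosed Ω₀) (s₀ : Spec (.of Ω₀) ⟶ S),
      s₀.base (IsLocalRing.closedPoint Ω₀) ∈ connectedComponent x ∧
        ∃ Θ₀ : CartierDivisor (A.fibre s₀).toAbelianVariety.X.left,
          A.IsLambdaOfAt s₀ D pol.lam Θ₀ ∧ Nonempty (φ.SymplecticLift s₀ Θ₀ δ)) :
    φ.IsSymplecticLiftable pol δ := by
  intro Ω _ _ s Θ hΘ hlam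
  obtain ⟨Ω₀, _, _, s₀, hs₀, Θ₀, hlam₀, ⟨Λ₀⟩⟩ := h (s.base (IsLocalRing.closedPoint Ω))
  -- `s` is centred in the connected component of the centre of `s₀`; spread the lift from `s₀` to `s`
  exact AbelianSchemeOver.LevelStructure.nonempty_symplecticLift_of_mem_connectedComponent A pol φ δ hg hQ hN
    (connectedComponent_eq hs₀ ▸ mem_connectedComponent) s₀ rfl hlam₀ Λ₀ s rfl hΘ hlam

/-- **The same over a field of characteristic zero** (`S → Spec K`, `CharZero K` — e.g. any `ℚ`-scheme): one symplectic lift at one geometric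
point per connected component gives `IsSymplecticLiftable`. [cite: Lan2013PELCompactifications, §1.3.6 Lemma 1.3.6.6 and Cor. 1.3.6.7 (pp. 81–82)] -/
theorem _root_.Literature.AlgebraicGeometry.AbelianSchemes.AbelianSchemeOver.LevelStructure.isSymplecticLiftable_of_forall_exists_symplecticLift_of_charZero
    {S : Scheme.{u}} [IsLocallyNoetherian S] {K : Type u} [Field K] [CharZero K] (f : S ⟶ Spec (.of K))
    {A : AbelianSchemeOver S} {g₀ : ℕ} (hg : A.IsOfRelDim g₀) {N : ℕ} (φ : A.LevelStructure g₀ N) (hN : N ≠ 0)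
    {D : A.DualPair} (pol : A.Polarization D) (δ : Fin g₀ → ℕ)
    (h : ∀ x : S, ∃ (Ω₀ : Type u) (_ : Field Ω₀) (_ : IsAlgClosed Ω₀) (s₀ : Spec (.of Ω₀) ⟶ S),
      s₀.base (IsLocalRing.closedPoint Ω₀) ∈ connectedComponent x ∧
        ∃ Θ₀ : CartierDivisor (A.fibre s₀).toAbelianVariety.X.left,
          A.IsLambdaOfAt s₀ D pol.lam Θ₀ ∧ Nonempty (φ.SymplecticLift s₀ Θ₀ δ)) :
    φ.IsSymplecticLiftable pol δ :=
  φ.isSymplecticLiftable_of_forall_exists_symplecticLift hg (natCast_residueField_ne_zero_of_charZero' f) hN pol δ h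

/-! ### §2 The heads over `X = (M_K) ⊗_L Fᵢ`: symplectic-liftability from the special complex fibres -/

set_option maxHeartbeats 400000 in
/-- **(m1), PER-COMPONENT GLUE — SYMPLECTIC-LIFTABILITY over `X := (M_K) ⊗_L Fᵢ` is read off the special complex fibres**: for an abelian scheme `A`
over `X` of relative dimension `g₀`, a level-`N` structure `φ` (`N ≠ 0`) and a polarisation `λ`, if at every honest complex point `P` of `X_ℂ` lying flat
over a special point `[τw, aK]` of `M_K` the fibre at the `X`-point `P ≫ pr` carries a witness `Θ` of `λ̄` and a symplectic lift of `φ` of type `δ`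
(produced at a MARKED complex fibre by organ (B1)), then `φ` is symplectic-liftable of type `δ` for `λ` (`X` smooth over `Fᵢ ⊇ L ⊇ ℚ`: locally
Noetherian, residue characteristic `0`; one special point per component by ★ `exists_specialPoint_base_mem_connectedComponent`).
[cite: Lan2013PELCompactifications, §1.3.6 Lemma 1.3.6.6 and Cor. 1.3.6.7 (pp. 81–82)] [cite: Deligne1979ShimuraVarieties, 2.1.2–2.1.3] -/
theorem isSymplecticLiftable_of_forall_specialPoint (S : RecordSystemGS L Jstar τ K₀) (K : C5.SmallLevel K₀)
    {Fi : Type} [Field Fi] [Algebra L Fi] (τE : Fi →+* ℂ) (hτE : τE.comp (algebraMap L Fi) = τ)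
    {A : AbelianSchemeOver ((baseChange L Fi).obj (S.M.obj K)).left} {g₀ : ℕ} (hg : A.IsOfRelDim g₀)
    {N : ℕ} (φ : A.LevelStructure g₀ N) (hN : N ≠ 0) {D : A.DualPair} (pol : A.Polarization D) (δ : Fin g₀ → ℕ)
    (h : letI : Algebra Fi ℂ := τE.toAlgebra
      letI : Algebra L ℂ := τ.toAlgebra
      ∀ (w : Fin 2 → L) (hw : (fun i => τ (w i)) ∈ negCone (Jstar.map τ))
        (a : ↥(finAdelic (↥(maximalRealSubfield L)) L (IsCMField.complexConj L) 2 Jstar))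
        (P : ComplexPoints ((baseChange Fi ℂ).obj ((baseChange L Fi).obj (S.M.obj K)))),
        P.left ≫ pullback.fst ((baseChange L Fi).obj (S.M.obj K)).hom (bcSpec Fi ℂ) ≫
            pullback.fst (S.M.obj K).hom (bcSpec L Fi) =
          ((S.pts K).symm (ShimuraSetGS.mk L Jstar τ K.1.1 (fun i => τ (w i)) hw a)).left →
        ∃ Θ : CartierDivisor
            (A.fibre (P.left ≫ pullback.fst ((baseChange L Fi).obj (S.M.obj K)).hom (bcSpec Fi ℂ))).toAbelianVariety.X.left,
          A.IsLambdaOfAt (P.left ≫ pullback.fst ((baseChange L Fi).obj (S.M.obj K)).hom (bcSpec Fi ℂ)) D pol.lam Θ ∧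
            Nonempty (φ.SymplecticLift (P.left ≫ pullback.fst ((baseChange L Fi).obj (S.M.obj K)).hom (bcSpec Fi ℂ)) Θ δ)) :
    φ.IsSymplecticLiftable pol δ := by
  letI : Algebra Fi ℂ := τE.toAlgebra
  letI : Algebra L ℂ := τ.toAlgebra
  -- `X` is locally Noetherian (smooth over the field `Fᵢ`) of residue characteristic `0`
  haveI := S.smooth K
  haveI : Smooth (S.M.obj K).hom := SmoothOfRelativeDimension.smooth 1 _
  haveI : Smooth ((baseChange L Fi).obj (S.M.obj K)).hom := by
    change Smooth (pullback.snd (S.M.obj K).hom _)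
    infer_instance
  haveI : IsLocallyNoetherian ((baseChange L Fi).obj (S.M.obj K)).left :=
    LocallyOfFiniteType.isLocallyNoetherian ((baseChange L Fi).obj (S.M.obj K)).hom
  haveI : CharZero Fi := charZero_of_injective_algebraMap (algebraMap L Fi).injective
  refine φ.isSymplecticLiftable_of_forall_exists_symplecticLift_of_charZero ((baseChange L Fi).obj (S.M.obj K)).hom hg hN pol δ
    fun x => ?_
  obtain ⟨w, hw, a, P, hP, hflat⟩ := S.exists_specialPoint_base_mem_connectedComponent K τE hτE x
  exact ⟨ℂ, inferInstance, inferInstance, P.left ≫ pullback.fst ((baseChange L Fi).obj (S.M.obj K)).hom (bcSpec Fi ℂ), hP,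
    h w hw a P hflat⟩

set_option maxHeartbeats 400000 in
/-- **(m1), PER-COMPONENT GLUE IN SHEET CURRENCY — symplectic-liftability over `X` from one witness-and-lift at each sheet point `ℓ_{τE}(z₀)` of the
special points `z₀ = (S.pts K)⁻¹ [τw, aK]`** (the currency of the E-sheet socket and of organ (B1) «fibre lift at the special sheet points of the twisted
tuple»; `eE` is the chart sheet `τE` as an `L`-algebra map). [cite: Lan2013PELCompactifications, §1.3.6 Lemma 1.3.6.6 and Cor. 1.3.6.7 (pp. 81–82)]
[cite: Deligne1979ShimuraVarieties, 2.1.2–2.1.3] -/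
theorem isSymplecticLiftable_of_forall_specialPoint_sheet (S : RecordSystemGS L Jstar τ K₀) (K : C5.SmallLevel K₀)
    {Fi : Type} [Field Fi] [Algebra L Fi] (τE : Fi →+* ℂ) (hτE : τE.comp (algebraMap L Fi) = τ)
    (eE : letI : Algebra L ℂ := τ.toAlgebra; Fi →ₐ[L] ℂ) (heE : ∀ x, eE x = τE x)
    {A : AbelianSchemeOver ((baseChange L Fi).obj (S.M.obj K)).left} {g₀ : ℕ} (hg : A.IsOfRelDim g₀)
    {N : ℕ} (φ : A.LevelStructure g₀ N) (hN : N ≠ 0) {D : A.DualPair} (pol : A.Polarization D) (δ : Fin g₀ → ℕ)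
    (h : letI : Algebra L ℂ := τ.toAlgebra
      ∀ (w : Fin 2 → L) (hw : (fun i => τ (w i)) ∈ negCone (Jstar.map τ))
        (a : ↥(finAdelic (↥(maximalRealSubfield L)) L (IsCMField.complexConj L) 2 Jstar)),
        ∃ Θ : CartierDivisor (A.fibre (Motives.thickeningLift eE (S.M.obj K)
            ((S.pts K).symm (ShimuraSetGS.mk L Jstar τ K.1.1 (fun i => τ (w i)) hw a))).left).toAbelianVariety.X.left,
          A.IsLambdaOfAt (Motives.thickeningLift eE (S.M.obj K)
              ((S.pts K).symm (ShimuraSetGS.mk L Jstar τ K.1.1 (fun i => τ (w i)) hw a))).left D pol.lam Θ ∧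
            Nonempty (φ.SymplecticLift (Motives.thickeningLift eE (S.M.obj K)
              ((S.pts K).symm (ShimuraSetGS.mk L Jstar τ K.1.1 (fun i => τ (w i)) hw a))).left Θ δ)) :
    φ.IsSymplecticLiftable pol δ := by
  letI : Algebra Fi ℂ := τE.toAlgebra
  letI : Algebra L ℂ := τ.toAlgebra
  refine S.isSymplecticLiftable_of_forall_specialPoint K τE hτE hg φ hN pol δ fun w hw a P hflat => ?_
  -- transport the clause along `P ≫ pr = ℓ_{eE}(z₀)` (dependent types: substitute a point variable)
  have key : ∀ {s s' : Spec (.of ℂ) ⟶ ((baseChange L Fi).obj (S.M.obj K)).left}, s = s' →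
      (∃ Θ : CartierDivisor (A.fibre s').toAbelianVariety.X.left,
          A.IsLambdaOfAt s' D pol.lam Θ ∧ Nonempty (φ.SymplecticLift s' Θ δ)) →
        ∃ Θ : CartierDivisor (A.fibre s).toAbelianVariety.X.left,
          A.IsLambdaOfAt s D pol.lam Θ ∧ Nonempty (φ.SymplecticLift s Θ δ) := by
    rintro s s' rfl h'
    exact h'
  exact key (S.left_comp_fst_eq_thickeningLift_left K τE eE heE P _ hflat) (h w hw a)

/-! ### §3 Both LEG-A binders `(hT, hsymp)` from one witness-and-lift per special sheet point -/

set_option maxHeartbeats 400000 in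
/-- **`HasType δ` AND `IsSymplecticLiftable` over `X` from ONE witness-and-lift at each special sheet point `ℓ_{τE}(z₀)`** — the two binders `(hT, hsymp)`
of ★ `SerreTwistModuliTupleRowA.exists_serreTwist_moduliTuple_of_isCMField_rowA` in one call from the (B1) organ: the `δ`-clause of the `HasType` twin ★
`hasType_of_forall_specialPoint_sheet` is read off the symplectic lift by ★ `Polarization.exists_mulHom_range_eq_kerPointsAt_of_symplecticLift` (`ℂ`
algebraically closed of characteristic `0`, `δ` a polarisation type), and §2 gives `IsSymplecticLiftable`.
[cite: MumfordFogartyKirwan1994, App. 7A (pp. 234–235)] [cite: Lan2013PELCompactifications, §1.3.6 Lemma 1.3.6.5 (p. 81), Lemma 1.3.6.6 and Cor. 1.3.6.7 (pp. 81–82)] -/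
theorem hasType_and_isSymplecticLiftable_of_forall_specialPoint_sheet (S : RecordSystemGS L Jstar τ K₀) (K : C5.SmallLevel K₀)
    {Fi : Type} [Field Fi] [Algebra L Fi] (τE : Fi →+* ℂ) (hτE : τE.comp (algebraMap L Fi) = τ)
    (eE : letI : Algebra L ℂ := τ.toAlgebra; Fi →ₐ[L] ℂ) (heE : ∀ x, eE x = τE x)
    {A : AbelianSchemeOver ((baseChange L Fi).obj (S.M.obj K)).left} {g₀ : ℕ} (hg : A.IsOfRelDim g₀)
    {N : ℕ} (φ : A.LevelStructure g₀ N) (hN : N ≠ 0) {D : A.DualPair} (pol : A.Polarization D)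
    {δ : Fin g₀ → ℕ} (hδ : IsPolarizationType δ)
    (h : letI : Algebra L ℂ := τ.toAlgebra
      ∀ (w : Fin 2 → L) (hw : (fun i => τ (w i)) ∈ negCone (Jstar.map τ))
        (a : ↥(finAdelic (↥(maximalRealSubfield L)) L (IsCMField.complexConj L) 2 Jstar)),
        ∃ Θ : CartierDivisor (A.fibre (Motives.thickeningLift eE (S.M.obj K)
            ((S.pts K).symm (ShimuraSetGS.mk L Jstar τ K.1.1 (fun i => τ (w i)) hw a))).left).toAbelianVariety.X.left,
          A.IsLambdaOfAt (Motives.thickeningLift eE (S.M.obj K)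
              ((S.pts K).symm (ShimuraSetGS.mk L Jstar τ K.1.1 (fun i => τ (w i)) hw a))).left D pol.lam Θ ∧
            Nonempty (φ.SymplecticLift (Motives.thickeningLift eE (S.M.obj K)
              ((S.pts K).symm (ShimuraSetGS.mk L Jstar τ K.1.1 (fun i => τ (w i)) hw a))).left Θ δ)) :
    pol.HasType δ ∧ φ.IsSymplecticLiftable pol δ := by
  letI : Algebra L ℂ := τ.toAlgebra
  -- the `δ`-clause at a point from a witness-and-lift there (a point VARIABLE keeps the dependent types syntactic)
  have key : ∀ (s : Spec (.of ℂ) ⟶ ((baseChange L Fi).obj (S.M.obj K)).left),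
      (∃ Θ : CartierDivisor (A.fibre s).toAbelianVariety.X.left,
          A.IsLambdaOfAt s D pol.lam Θ ∧ Nonempty (φ.SymplecticLift s Θ δ)) →
        ∃ ψ : Multiplicative (((i : Fin g₀) → ZMod (δ i)) × ((i : Fin g₀) → ZMod (δ i))) →*
          (A.fibre s).toAbelianVariety.Points ℂ, Function.Injective ψ ∧ Set.range ψ = pol.kerPointsAt s := by
    rintro s ⟨Θ, hlam, ⟨Λ⟩⟩
    exact pol.exists_mulHom_range_eq_kerPointsAt_of_symplecticLift φ hN hδ s hlam Λ
  exact ⟨S.hasType_of_forall_specialPoint_sheet K τE hτE eE heE pol hδ fun w hw a => key _ (h w hw a),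
    S.isSymplecticLiftable_of_forall_specialPoint_sheet K τE hτE eE heE hg φ hN pol δ h⟩

end RecordSystemGS

end Literature.AlgebraicGeometry.ShimuraVarieties.UnitaryCanonicalModel

end
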